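import Summits.CriticalPhenomena.PercolationContinuityZ3.Theorems.PercNearOneGluingNoHeavyLowerTailSahiPivotFamily
import Mathlib
import HarnessLib
import HarnessLib.Audit.Tags

/-!
# `NoHeavyLowerTail` (crux stmt-CriticalPhenomena-4575), master-family line P1 (gen 15), companion to `…SahiPivotFamily`:
# FACET DOMINATION — the pivot family is CP3⁺ at pure patterns plus ONE transfer principle

Support file (seat `prim-masterthm-p1`, gen 15; `--supports stmt-CriticalPhenomena-4575`).  One typed conjecture and two kernel links;
no `sorry`, standard axioms.  Memo `run/shared/lean/prim/prim-masterthm/FROM-prim-masterthm-p1-g15-PIVOT-FAMILY.md` §9.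

With `Ψ^S_U(f) = pivotSum S U f` (pivots restricted to subsets of `U`, pairs antipodal in the complementary sub-cube of `2^S`):
**facet domination** says `Ψ^S_U(f) ≥ Ψ^U_U(f)` for `U ⊆ S` — the member with pivot set `U` on ANY bigger cube dominates the full
tripartition functional (CP3⁺ form) of the sub-cube `2^U` itself.  `U = ∅` is the proved Gladkov end (`pivotSum_empty_nonneg`,
`pivotSum_empty_mono`), `U = S ∖ {e}` is `LowerSectionDomination` (conjecture M of the memo), `U = S` is equality.  Together with CP3⁺ on every
cube (`PurePatternCP3Plus`) it gives the whole family `PivotFamilyNonneg` (`0 ≤ Ψ^U_U ≤ Ψ^S_U`), so the family is exactly "CP3⁺ + facet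
domination".  Census (gen 15): EXHAUSTIVE on `2^5` — all 49 861 021 sunflower labelings × 31 proper pivot sets = 1 545 691 651 pairs, 0 failures,
minimum 0 (`code-g15/exh5c.c`) — and ≈ 8·10⁶ random/annealed triples on `2^4 … 2^7` (ratio exactly `1` attained whenever `|S ∖ U| ≤ 3`).
The step-by-step version `Ψ^S_U ≥ Ψ^{S∖e}_U` for `∅ ⊊ U ⊊ S∖e` is FALSE (2^4: 272 700 of 6.4·10⁶), so domination is against the facet, not a chain of
one-coordinate monotonicities.  HONEST FRAMING: typed conjecture + links; OPEN. [this work]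
-/

namespace Summit.CriticalPhenomena.PercolationContinuityZ3.Theorems

namespace SahiPivotFamily

open Finset AntipodalStrongHarris AntipodalStrongHarris.Lab

variable {k : ℕ}

/-- **CONJECTURE (facet domination; typed).**  For every sunflower labeling `F` of the finite subsets of `ℕ` and `U ⊆ S`:
`Ψ^U_U(F) ≤ Ψ^S_U(F)`.  Contains `LowerSectionDomination` (`S = U ∪ {e}`); with `PurePatternCP3Plus` it gives `PivotFamilyNonneg`.
Exhaustive on `2^5`, adversarially clean on `2^6, 2^7`; tight. [this work] [status: open] -/
@[conjecture] def FacetDomination (k : ℕ) : Prop :=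
  ∀ (S U : Finset ℕ) (F : Finset ℕ → Lab k), (∀ ⦃X Y : Finset ℕ⦄, X ⊆ Y → F X ≤ F Y) → U ⊆ S →
    pivotSum U U F ≤ pivotSum S U F

/-- Facet domination contains lower-section domination (`U = S ⊆ S ∪ {e}`). [this work] -/
theorem lowerSectionDomination_of_facetDomination (h : FacetDomination k) : LowerSectionDomination k :=
  fun S e F _ hF => h (insert e S) S F hF (subset_insert e S)

/-- **The pivot family = CP3⁺ at pure patterns + facet domination**: `0 ≤ Ψ^U_U(F) ≤ Ψ^S_U(F)`. [this work] -/
theorem pivotFamilyNonneg_of_facetDomination (h1 : FacetDomination k) (h2 : PurePatternCP3Plus k) :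
    PivotFamilyNonneg k :=
  fun S U F hF hUS => le_trans (h2 U F hF) (h1 S U F hF hUS)

end SahiPivotFamily

end Summit.CriticalPhenomena.PercolationContinuityZ3.Theorems
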